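import Mathlib
import HarnessLib
import Literature.Computability.AlgebraicComplexity.PatternExpressions
import Summits.ValiantsHypothesis.ValiantsHypothesis.Theorems.MonotoneRestorationMonotoneRestorationQPLinearWidthDefs
import Summits.ValiantsHypothesis.ValiantsHypothesis.Theorems.MonotoneRestorationMonotoneRestorationQPLinearWidthHomIndistShift
import Summits.ValiantsHypothesis.ValiantsHypothesis.Theorems.MonotoneRestorationMonotoneRestorationQPLinearWidthDirectSumCongruence

/-!
# Route MonotoneRestoration, crux `MonotoneRestorationQP` (stmt-15886), line `linear_width` —
# THE VERTEX-DISJOINT SPLIT FORMULA FOR WEIGHTED DIRECT SUMS AND THE RAW COMPONENT RELATION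

Helper file (`--supports stmt-ValiantsHypothesis-15886`), def-free.

`DirectSumCongruence` (p840830) expands `hom_F(Z + Y)` over the edge splits `(E₀, E₁)` of `F` (`eval_add_homPoly`) and
shows that, for `Z` and `Y` supported on the two blocks of a 2-colouring of the indices, splits sharing a vertex vanish
and vertex-disjoint splits factor.  This file records the resulting closed formula and the relation it imposes on a
determined hom expansion — the raw form of the COMPONENT ISOLATION of Dawar–Pago–Seppelt 2025 §7.1.1 (vertex-disjoint
edge splits of an isolated-vertex-free pattern are exactly the splits along unions of connected components):

* `mul_eval_homPoly_add_eq_sum_splits` — **SPLIT FORMULA**: `n^a · n^b · hom_F(Z + Y) = Σ hom_{E₀}(Z) · hom_{E₁}(Y)`, the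
  sum over the VERTEX-DISJOINT edge splits `(E₀, E₁)` of `F` (both halves on the vertex set of `F`, so each carries
  the other's vertices as isolated ones — whence the factor `n^a · n^b`);
* `sum_splits_sub_mul_eq_zero_of_determined` — **RAW COMPONENT RELATION**: if `Σ_i α_i hom_{F_i,n}` is determined by
  `HomIndist n k`, `Z, Z'` (one block) are `HomIndist n k`-related and `Y` lives on the other block, then
  `Σ_i α_i/(n^{a_i} n^{b_i}) · Σ_{(E₀,E₁) vertex-disjoint split of F_i} (hom_{E₀}(Z) − hom_{E₀}(Z')) · hom_{E₁}(Y) = 0`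
  for EVERY such `Y` — a polynomial identity in the second block from which component-wise determinedness is to be
  extracted by uniqueness of hom expansions (`HomExpansionUnique.homPoly_linearIndependent`) once the `E₁`'s are
  grouped by isomorphism class (NOT done here: that grouping is the remaining [M/L] step named in the census).

Honest label: bookkeeping on top of p840830; no stub closed; the rung, the cruxes and VP ≠ VNP are NOT moved.
[cite: DawarPagoSeppelt2025, §7.1.1; Lovasz2012, eq. (5.28)–(5.30)]
-/

set_option linter.dupNamespace false

noncomputable section

open scoped Classical

namespace Summit.ValiantsHypothesis.ValiantsHypothesis.Theorems.DirectSumSplits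

open MvPolynomial Finset
open Literature.Computability.AlgebraicComplexity
open Summit.ValiantsHypothesis.ValiantsHypothesis.Theorems.MonotoneRestorationQPLinearWidth
open Summit.ValiantsHypothesis.ValiantsHypothesis.Theorems.DirectSumCongruence

variable {n : ℕ}

/-- **THE VERTEX-DISJOINT SPLIT FORMULA.**  For `Z` supported on the block `κ = false` and `Y` on the block `κ = true`
of a 2-colouring `κ` of `Fin n`, and any bipartite pattern `F` on `Fin a ⊔ Fin b`:
`n^a · n^b · hom_{F,n}(Z + Y) = Σ_{(E₀,E₁)} hom_{E₀,n}(Z) · hom_{E₁,n}(Y)`, the sum over the edge splits of `F` whose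
two halves have no common vertex. [cite: DawarPagoSeppelt2025, §7.1.1; Lovasz2012, eq. (5.28)] -/
theorem mul_eval_homPoly_add_eq_sum_splits {a b : ℕ} (κ : Fin n → Bool) {Z Y : Fin n × Fin n → ℂ}
    (hZ : ∀ p q, Z (p, q) ≠ 0 → κ p = false ∧ κ q = false)
    (hY : ∀ p q, Y (p, q) ≠ 0 → κ p = true ∧ κ q = true) (F : Multiset (Fin a × Fin b)) :
    ((n ^ a * n ^ b : ℕ) : ℂ) * eval (Z + Y) (homPoly F n ℂ) =
      (((Multiset.antidiagonal F).filter fun p =>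
          (∀ i, (∃ e ∈ p.1, e.1 = i) → (∃ e ∈ p.2, e.1 = i) → False) ∧
            ∀ j, (∃ e ∈ p.1, e.2 = j) → (∃ e ∈ p.2, e.2 = j) → False).map
        fun p => eval Z (homPoly p.1 n ℂ) * eval Y (homPoly p.2 n ℂ)).sum := by
  -- abbreviations: the mixed sum of a split and the vertex-disjointness predicate
  let mixed : Multiset (Fin a × Fin b) × Multiset (Fin a × Fin b) → ℂ := fun p =>
    ∑ h : (Fin a → Fin n) × (Fin b → Fin n),
      (p.1.map fun e => Z (h.1 e.1, h.2 e.2)).prod * (p.2.map fun e => Y (h.1 e.1, h.2 e.2)).prod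
  let P : Multiset (Fin a × Fin b) × Multiset (Fin a × Fin b) → Prop := fun p =>
    (∀ i, (∃ e ∈ p.1, e.1 = i) → (∃ e ∈ p.2, e.1 = i) → False) ∧
      ∀ j, (∃ e ∈ p.1, e.2 = j) → (∃ e ∈ p.2, e.2 = j) → False
  have hAD : eval (Z + Y) (homPoly F n ℂ) = ((Multiset.antidiagonal F).map mixed).sum := eval_add_homPoly F Z Y
  -- vertex-sharing splits contribute nothing
  have hshared : ((Multiset.filter (fun p => ¬ P p) (Multiset.antidiagonal F)).map
      fun p => ((n ^ a * n ^ b : ℕ) : ℂ) * mixed p).sum = 0 := by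
    refine Multiset.sum_eq_zero fun x hx => ?_
    obtain ⟨p, hp, rfl⟩ := Multiset.mem_map.1 hx
    have hns : ¬ P p := (Multiset.mem_filter.1 hp).2
    have hshare : (∃ i, (∃ e ∈ p.1, e.1 = i) ∧ ∃ e ∈ p.2, e.1 = i) ∨
        ∃ j, (∃ e ∈ p.1, e.2 = j) ∧ ∃ e ∈ p.2, e.2 = j := by
      by_contra hno
      rw [not_or, not_exists, not_exists] at hno
      exact hns ⟨fun i h0 h1 => hno.1 i ⟨h0, h1⟩, fun j h0 h1 => hno.2 j ⟨h0, h1⟩⟩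
    have h0 : mixed p = 0 := sum_mixed_eq_zero_of_shared κ hZ hY p.1 p.2 hshare
    rw [h0, mul_zero]
  -- vertex-disjoint splits factor
  have hdisj : ((Multiset.filter P (Multiset.antidiagonal F)).map
      fun p => eval Z (homPoly p.1 n ℂ) * eval Y (homPoly p.2 n ℂ)) =
      (Multiset.filter P (Multiset.antidiagonal F)).map fun p => ((n ^ a * n ^ b : ℕ) : ℂ) * mixed p := by
    refine Multiset.map_congr rfl fun p hp => ?_
    obtain ⟨hrow, hcol⟩ : P p := (Multiset.mem_filter.1 hp).2
    rw [mul_comm (((n ^ a * n ^ b : ℕ) : ℂ))]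
    exact (sum_mixed_mul_card Z Y p.1 p.2 hrow hcol).symm
  show ((n ^ a * n ^ b : ℕ) : ℂ) * eval (Z + Y) (homPoly F n ℂ) =
    ((Multiset.filter P (Multiset.antidiagonal F)).map
      fun p => eval Z (homPoly p.1 n ℂ) * eval Y (homPoly p.2 n ℂ)).sum
  rw [hdisj, hAD, ← Multiset.sum_map_mul_left]
  conv_lhs => rw [← Multiset.filter_add_not P (Multiset.antidiagonal F)]
  rw [Multiset.map_add, Multiset.sum_add, hshared, add_zero]

/-- **THE RAW COMPONENT RELATION.**  Let `p = Σ_i α_i hom_{F_i,n}` be determined by `HomIndist n k` on `ℂ^{n×n}`, let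
`Z, Z'` be supported on the block `κ = false` with `HomIndist n k Z Z'`, and let `Y` be supported on the block
`κ = true`.  Then
`Σ_i α_i · (n^{a_i} n^{b_i})⁻¹ · Σ_{(E₀,E₁) vertex-disjoint split of F_i} (hom_{E₀}(Z) − hom_{E₀}(Z')) · hom_{E₁}(Y) = 0`.
(From `homIndist_add_of_blockSeparated` and the split formula; for a CONNECTED `F_i` only the two trivial splits occur and
the relation collapses to level-downward monotonicity.) [cite: DawarPagoSeppelt2025, §7.1.1] -/
theorem sum_splits_sub_mul_eq_zero_of_determined {k M : ℕ} (hn : 0 < n) (κ : Fin n → Bool)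
    {Z Z' Y : Fin n × Fin n → ℂ}
    (hZ : ∀ p q, Z (p, q) ≠ 0 → κ p = false ∧ κ q = false)
    (hZ' : ∀ p q, Z' (p, q) ≠ 0 → κ p = false ∧ κ q = false)
    (hY : ∀ p q, Y (p, q) ≠ 0 → κ p = true ∧ κ q = true)
    (a b : Fin M → ℕ) (E : (i : Fin M) → Multiset (Fin (a i) × Fin (b i))) (α : Fin M → ℂ)
    (hdet : ∀ A B : Fin n × Fin n → ℂ, HomIndist n k A B →
      eval A (∑ i, C (α i) * homPoly (E i) n ℂ) = eval B (∑ i, C (α i) * homPoly (E i) n ℂ))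
    (h : HomIndist n k Z Z') :
    ∑ i, α i * (((n ^ a i * n ^ b i : ℕ) : ℂ)⁻¹ *
      (((Multiset.antidiagonal (E i)).filter fun p =>
          (∀ u, (∃ e ∈ p.1, e.1 = u) → (∃ e ∈ p.2, e.1 = u) → False) ∧
            ∀ v, (∃ e ∈ p.1, e.2 = v) → (∃ e ∈ p.2, e.2 = v) → False).map
        fun p => (eval Z (homPoly p.1 n ℂ) - eval Z' (homPoly p.1 n ℂ)) * eval Y (homPoly p.2 n ℂ)).sum) = 0 := by
  -- the two evaluations of `p` agree
  have key := hdet (Z + Y) (Z' + Y) (homIndist_add_of_blockSeparated κ hZ hZ' hY h)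
  rw [map_sum, map_sum, ← sub_eq_zero, ← Finset.sum_sub_distrib] at key
  rw [← key]
  refine Finset.sum_congr rfl fun i _ => ?_
  rw [map_mul, map_mul, eval_C, eval_C, ← mul_sub]
  congr 1
  -- per pattern: divide the split formula by `n^{a_i} n^{b_i}`
  have hc : ((n ^ a i * n ^ b i : ℕ) : ℂ) ≠ 0 := Nat.cast_ne_zero.2 (by positivity)
  apply mul_left_cancel₀ hc
  rw [← mul_assoc, mul_inv_cancel₀ hc, one_mul, mul_sub,
    mul_eval_homPoly_add_eq_sum_splits κ hZ hY (E i), mul_eval_homPoly_add_eq_sum_splits κ hZ' hY (E i),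
    ← Multiset.sum_map_sub]
  refine congrArg _ (Multiset.map_congr rfl fun p _ => ?_)
  ring

end Summit.ValiantsHypothesis.ValiantsHypothesis.Theorems.DirectSumSplits

end
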